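import Literature.NumberTheory.DiophantineGeometry.FunctionFieldArtinSchreierSplitting
import Mathlib.RingTheory.Trace.Basic
import HarnessLib

/-!
# Place counts in an Artin–Schreier extension `M = L(y)`, `y^p - y = u`, when `u` comes from a
subfield `K ⊆ L`: the residue-field tower and the count over the places of `L` above a place of `K`

Topic: `Literature/NumberTheory/DiophantineGeometry`. Continuation of `FunctionFieldArtinSchreierSplitting`
(complete splitting / inertness of a place `w` of `L` in `M` according to the trace
`Tr_{L_w/𝔽_p}(ū)`, and the contribution `Σ_{w'|w, deg w' ∣ r} deg w'` of `w` to the place count `N_r(M)`).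
Here `u = g ∈ K` for a tower `K ⊆ L ⊆ M` of function fields over the finite field `k` of
characteristic `p`, and `w` runs over the places of `L` above a place `v` of `K` at which `g` is
integral:

* `PlaceOver.trace_residue_resHom` — **the residue-field tower**: for `w | v` and `a ∈ 𝒪_v`,
  `Tr_{L_w/𝔽_p}(ā) = [L_w : K_v] · Tr_{K_v/𝔽_p}(ā)` with `[L_w : K_v] = deg w / deg v`
  (`PlaceOver.degree_div_degree_eq_finrank`; transitivity of the trace);
* `PlaceOver.sum_degree_placesOver_artinSchreier_of_restrict_eq` — the contribution of one `w | v`: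
  `p · deg w · [deg w ∣ r]` if `(deg w / deg v) · Tr_{K_v/𝔽_p}(ḡ) = 0` in `𝔽_p`, and
  `p · deg w · [p · deg w ∣ r]` otherwise;
* **`PlaceOver.sum_sum_degree_placesOver_artinSchreier`** — summed over a set `S` of places of `L`
  above `v` all of the same degree `f · deg v` with `#S · f = n` (as for the places above an
  unramified place in a Galois extension `L/K` of degree `n`, `f` the common residue degree):
  `Σ_{w ∈ S} Σ_{w' | w, deg w' ∣ r} deg w' = n · p · deg v · [f deg v ∣ r]` if `f · Tr_{K_v/𝔽_p}(ḡ) = 0`,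
  and `= n · p · deg v · [p f deg v ∣ r]` otherwise.

This is the Artin–Schreier half of the point count of the Lang–Artin–Schreier covering
`z^p - z = λ(α x)` of an elliptic function field used for the Kohel–Shparlinski bound
(`Literature.NumberTheory.EllipticCurves.KohelShparlinski.CoordinateCharSumBound`); the other half is the
decomposition of the places of `k(W)` in the Lang covering. Everything is proved; no definitions; no
named facts.

## References

* H. Stichtenoth, *Algebraic Function Fields and Codes*, 2nd ed., GTM 254, Springer 2009: Def. 3.1.5
  (relative degree), Thm. 3.3.7, Prop. 3.7.8. [Stichtenoth2009]
* R. Lidl, H. Niederreiter, *Finite Fields*, Thm. 2.26 (transitivity of the trace). [LidlNiederreiter1996]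
-/

noncomputable section

open scoped Classical IntermediateField
open Polynomial

namespace Literature.NumberTheory.DiophantineGeometry.AlgFunctionField

namespace PlaceOver

open Literature.FieldTheory.ArtinSchreier

universe u v

variable {k : Type u} {K : Type v} {L : Type v} [Field k] [Field K] [Algebra k K]
variable [Field L] [Algebra K L] [Algebra k L] [IsScalarTower k K L] [FiniteDimensional K L]

/-! ### The residue-field tower `𝔽_p ⊆ K_v ⊆ L_w` -/

section Tower

variable [IsAlgFunctionField k K] [IsAlgFunctionField k L] [Finite k]

omit [IsAlgFunctionField k L] [Finite k] in
/-- **`deg w / deg v = [L_w : K_v]`** for a place `w` of `L` above the place `v` of `K` (Stichtenoth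
Def. 3.1.5: `deg w = f(w|v) · deg v`), where `L_w` is a `K_v`-algebra through the residue map of
`𝒪_v → 𝒪_w`. [cite: Stichtenoth2009, Def. 3.1.5] -/
theorem degree_eq_finrank_mul_degree {v : PlaceOver k K} {w : PlaceOver k L}
    (h : w.restrict (K := k) (F := K) = v) :
    letI := (IsLocalRing.ResidueField.map (resHom v w (forall_mem_iff_of_restrict_eq h))).toAlgebra
    w.degree = Module.finrank v.residueField w.residueField * v.degree := by
  have hBP := forall_mem_iff_of_restrict_eq h
  set ρ := IsLocalRing.ResidueField.map (resHom v w hBP) with hρ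
  letI : Algebra v.residueField w.residueField := ρ.toAlgebra
  have hρK : ∀ c : k, ρ (algebraMap k v.residueField c) = algebraMap k w.residueField c := by
    intro c
    rw [PlaceOver.algebraMap_residueField_apply, PlaceOver.algebraMap_residueField_apply]
    change IsLocalRing.residue _ (resHom v w hBP (algebraMap k v.toValuationSubring c)) = _
    congr 1
    apply Subtype.ext
    change algebraMap K L (algebraMap k K c) = algebraMap k L c
    exact (IsScalarTower.algebraMap_apply k K L c).symm
  haveI : IsScalarTower k v.residueField w.residueField :=
    IsScalarTower.of_algebraMap_eq fun c => (hρK c).symm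
  rw [PlaceOver.degree, PlaceOver.degree, mul_comm, Module.finrank_mul_finrank k v.residueField w.residueField]

omit [IsAlgFunctionField k L] [Finite k] in
/-- `deg w / deg v = [L_w : K_v]` (natural-number division). [cite: Stichtenoth2009, Def. 3.1.5] -/
theorem degree_div_degree_eq_finrank {v : PlaceOver k K} {w : PlaceOver k L}
    (h : w.restrict (K := k) (F := K) = v) :
    letI := (IsLocalRing.ResidueField.map (resHom v w (forall_mem_iff_of_restrict_eq h))).toAlgebra
    w.degree / v.degree = Module.finrank v.residueField w.residueField := by
  have hpos : 0 < v.degree := PlaceOver.degree_pos_holds v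
  have := degree_eq_finrank_mul_degree h
  rw [this, Nat.mul_div_cancel _ hpos]

/-- **The residue-field tower for traces**: for `w | v`, `a ∈ 𝒪_v` and the prime field `𝔽_p`,
`Tr_{L_w/𝔽_p}(ā) = (deg w / deg v) · Tr_{K_v/𝔽_p}(ā)` (transitivity `Tr_{L_w/𝔽_p} = Tr_{K_v/𝔽_p} ∘ Tr_{L_w/K_v}`
and `Tr_{L_w/K_v}(ā) = [L_w : K_v] ā` for `ā ∈ K_v`). [cite: LidlNiederreiter1996, Thm. 2.26] -/
theorem trace_residue_resHom (p : ℕ) [Fact p.Prime] [CharP k p] {v : PlaceOver k K} {w : PlaceOver k L}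
    (h : w.restrict (K := k) (F := K) = v) [Algebra (ZMod p) v.residueField] [Algebra (ZMod p) w.residueField]
    (a : v.toValuationSubring) :
    Algebra.trace (ZMod p) w.residueField
        (IsLocalRing.residue w.toValuationSubring (resHom v w (forall_mem_iff_of_restrict_eq h) a)) =
      (w.degree / v.degree) • Algebra.trace (ZMod p) v.residueField (IsLocalRing.residue v.toValuationSubring a) := by
  have hBP := forall_mem_iff_of_restrict_eq h
  set ρ := IsLocalRing.ResidueField.map (resHom v w hBP) with hρ
  letI : Algebra v.residueField w.residueField := ρ.toAlgebra
  haveI : Finite v.residueField := PlaceOver.finite_residueField v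
  haveI : Finite w.residueField := PlaceOver.finite_residueField w
  haveI : FiniteDimensional (ZMod p) v.residueField := Module.Finite.of_finite
  haveI : FiniteDimensional v.residueField w.residueField := Module.Finite.of_finite
  haveI : IsScalarTower (ZMod p) v.residueField w.residueField :=
    IsScalarTower.of_algebraMap_eq fun c => by
      have hsub : (algebraMap (ZMod p) w.residueField) =
          (algebraMap v.residueField w.residueField).comp (algebraMap (ZMod p) v.residueField) :=
        Subsingleton.elim _ _
      exact congrFun (congrArg DFunLike.coe hsub) c
  have hres : IsLocalRing.residue w.toValuationSubring (resHom v w hBP a) =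
      algebraMap v.residueField w.residueField (IsLocalRing.residue v.toValuationSubring a) := rfl
  rw [hres, ← Algebra.trace_trace (S := v.residueField), Algebra.trace_algebraMap, map_nsmul,
    degree_div_degree_eq_finrank h]

end Tower

/-! ### The count over the places above a place of the subfield -/

variable {M : Type v} [Field M] [Algebra L M] [Algebra k M] [IsScalarTower k L M]
variable [IsAlgFunctionField k K] [IsAlgFunctionField k L] [FiniteDimensional L M]
  [Algebra.IsSeparable L M] [Finite k] [IsAlgFunctionField k M]
variable (p : ℕ) [Fact p.Prime] [CharP k p]

/-- **The contribution of a place `w | v` to `N_r(M)`** for `M = L(y)`, `y^p - y = g` with `g ∈ K`,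
`g ∈ 𝒪_v`: with `f = deg w / deg v` and `c = Tr_{K_v/𝔽_p}(ḡ)`, it is `p · deg w · [deg w ∣ r]` if
`f · c = 0` in `𝔽_p` (then `Tr_{L_w/𝔽_p}(ḡ) = 0` and `w` splits completely) and `p · deg w · [p deg w ∣ r]`
otherwise (`w` is inert). [cite: Stichtenoth2009, Prop. 3.7.8 and Thm. 3.3.7] -/
theorem sum_degree_placesOver_artinSchreier_of_restrict_eq {v : PlaceOver k K} {w : PlaceOver k L}
    (h : w.restrict (K := k) (F := K) = v) [Algebra (ZMod p) v.residueField] {g : K}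
    (hg : g ∈ v.toValuationSubring) {y : M} (hy : y ^ p - y = algebraMap L M (algebraMap K L g))
    (htop : L⟮y⟯ = ⊤) (hdeg : Module.finrank L M = p) (r : ℕ) :
    (∑ w' ∈ (w.finite_setOf_restrict_eq (F' := M)).toFinset,
        if w'.degree ∣ r then (w'.degree : ℕ) else 0) =
      if ((w.degree / v.degree : ℕ) : ZMod p) *
          Algebra.trace (ZMod p) v.residueField (IsLocalRing.residue v.toValuationSubring ⟨g, hg⟩) = 0 then
        (if w.degree ∣ r then p * w.degree else 0)
      else (if p * w.degree ∣ r then p * w.degree else 0) := by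
  have hBP := forall_mem_iff_of_restrict_eq h
  have hgw : algebraMap K L g ∈ w.toValuationSubring := (hBP g).2 hg
  haveI := charP_residueField p w
  letI : Algebra (ZMod p) w.residueField := ZMod.algebra _ p
  rw [w.sum_degree_placesOver_artinSchreier p hgw hy htop hdeg r,
    w.artinSchreier_split_iff_trace_eq_zero p]
  -- the residue of `algebraMap g` at `w` is the image of `ḡ`
  have hres : (⟨algebraMap K L g, hgw⟩ : w.toValuationSubring) = resHom v w hBP ⟨g, hg⟩ := rfl
  rw [hres, trace_residue_resHom p h ⟨g, hg⟩, nsmul_eq_mul]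
  -- the two sides now differ only in the `Decidable` instances of their conditions
  by_cases hc : ((w.degree / v.degree : ℕ) : ZMod p) *
      Algebra.trace (ZMod p) v.residueField (IsLocalRing.residue v.toValuationSubring ⟨g, hg⟩) = 0
  · simp only [hc, ↓reduceIte]
  · simp only [hc, ↓reduceIte]

/-- **The count over the places of `L` above `v`** ([KohelShparlinski2000]-type point count of a
Lang–Artin–Schreier covering, Artin–Schreier half). Let `M = L(y)`, `y^p - y = g`, `g ∈ K` integral at
the place `v` of `K` (degree `d`), and let `S` be a finite set of places of `L` above `v`, all of degree
`f · d`, with `#S · f = n`. Then for every `r`,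
`Σ_{w ∈ S} Σ_{w' | w, deg w' ∣ r} deg w' = n · p · d · [f d ∣ r]` if `f · Tr_{K_v/𝔽_p}(ḡ) = 0` in `𝔽_p`,
and `= n · p · d · [p f d ∣ r]` otherwise. [cite: Stichtenoth2009, Prop. 3.7.8 and Thm. 3.3.7] -/
theorem sum_sum_degree_placesOver_artinSchreier {v : PlaceOver k K} [Algebra (ZMod p) v.residueField]
    {g : K} (hg : g ∈ v.toValuationSubring) {y : M} (hy : y ^ p - y = algebraMap L M (algebraMap K L g))
    (htop : L⟮y⟯ = ⊤) (hdeg : Module.finrank L M = p) (S : Finset (PlaceOver k L))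
    (hS : ∀ w ∈ S, w.restrict (K := k) (F := K) = v) {f n : ℕ} (hf : ∀ w ∈ S, w.degree = f * v.degree)
    (hn : S.card * f = n) (r : ℕ) :
    (∑ w ∈ S, ∑ w' ∈ (w.finite_setOf_restrict_eq (F' := M)).toFinset,
        if w'.degree ∣ r then (w'.degree : ℕ) else 0) =
      if ((f : ℕ) : ZMod p) *
          Algebra.trace (ZMod p) v.residueField (IsLocalRing.residue v.toValuationSubring ⟨g, hg⟩) = 0 then
        (if f * v.degree ∣ r then n * p * v.degree else 0)
      else (if p * (f * v.degree) ∣ r then n * p * v.degree else 0) := by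
  have hpos : 0 < v.degree := PlaceOver.degree_pos_holds v
  have hterm : ∀ w ∈ S, (∑ w' ∈ (w.finite_setOf_restrict_eq (F' := M)).toFinset,
        if w'.degree ∣ r then (w'.degree : ℕ) else 0) =
      if ((f : ℕ) : ZMod p) *
          Algebra.trace (ZMod p) v.residueField (IsLocalRing.residue v.toValuationSubring ⟨g, hg⟩) = 0 then
        (if f * v.degree ∣ r then p * (f * v.degree) else 0)
      else (if p * (f * v.degree) ∣ r then p * (f * v.degree) else 0) := by
    intro w hw
    have hfd : w.degree / v.degree = f := by rw [hf w hw, Nat.mul_div_cancel _ hpos]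
    rw [sum_degree_placesOver_artinSchreier_of_restrict_eq p (hS w hw) hg hy htop hdeg r, hfd, hf w hw]
  rw [Finset.sum_congr rfl hterm, Finset.sum_const, smul_eq_mul]
  split_ifs <;> first
    | rw [mul_zero]
    | (rw [← hn]; ring)

end PlaceOver

end Literature.NumberTheory.DiophantineGeometry.AlgFunctionField
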